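import Summits.PneNP.PneNP.Theorems.SoloInformedIOShape
import Literature.Computability.Complexity.WorstCaseOneWay
import HarnessLib

/-!
# Solo (informed) — the cryptographic margin of `P ≠ NP`: worst-case one-wayness

`PneNP` is stated as `∃ L ∈ NP, L ∉ P`. This file records, as kernel-checked equivalences, where
the summit sits on the one-way-function axis:

* `soloInformed_pneNP_iff_exists_worstCase_oneWay` — `PneNP` holds iff there is a polynomial-time
  `f` that NO polynomial-time `g` inverts in the worst case (for every `g ∈ FP` some `x` with
  `f (g ⟨1^{|x|}, f x⟩) ≠ f x`). This is the complexity-theoretic (Grollmann–Selman / Rothe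
  Prop. 8.35) notion; the average-case notion used in cryptography (`IsOneWay` in
  `Literature/Computability/Cryptography/OneWayFunctions.lean`) is a strictly stronger-looking
  hypothesis and is NOT claimed equivalent here.
* `soloInformed_pneNP_iff_not_forall_invertible` — dually, `PneNP` fails iff every `FP` function
  has an `FP` inverter given the unary length of a preimage.

Both are two-line consequences of `Literature.Computability.Complexity.not_NP_subset_P_iff_exists_oneWay`
(tagged-verifier construction) and the solo I/O-shape lemma `soloInformed_pneNP_iff_exists_not_mem`.
-/

namespace Summit.PneNP.PneNP.Theorems

open Literature.Computability.Complexity _root_.Computability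

/-- **`P ≠ NP` iff a worst-case one-way function exists.**
[cite: RotheJ2005, Prop. 8.35 (held book:rothend-complexity-theory-cryptology chunk p0489)]
[cite: GrollmannSelman1988, §3 (worst-case one-way functions; theorem number not verified: source not held)] -/
theorem soloInformed_pneNP_iff_exists_worstCase_oneWay :
    PneNP ↔ ∃ f ∈ FP, ∀ g ∈ FP, ∃ (n : ℕ) (x : List Bool), x.length = n ∧
      f (g (boolPair (unaryEncodeNat n) (f x))) ≠ f x := by
  rw [soloInformed_pneNP_iff_exists_not_mem, ← not_NP_subset_P_iff_exists_oneWay, Set.not_subset]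

/-- **`P ≠ NP` iff NOT every polynomial-time function is polynomial-time invertible** (inverters
receive `⟨1ⁿ, f x⟩`, `|x| = n`). [cite: RotheJ2005, Prop. 8.35 (held book:rothend-complexity-theory-cryptology chunk p0489)]
[cite: TalbotWelsh2006, §6.2 and Thm. 6.6 (held book:talbot2006-complexity-cryptography-introduction p0101, p0103)] -/
theorem soloInformed_pneNP_iff_not_forall_invertible :
    PneNP ↔ ¬ ∀ f ∈ FP, ∃ g ∈ FP, ∀ (n : ℕ) (x : List Bool), x.length = n →
      f (g (boolPair (unaryEncodeNat n) (f x))) = f x := by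
  rw [soloInformed_pneNP_iff_exists_not_mem, ← NP_subset_P_iff_forall_exists_inverter, Set.not_subset]

end Summit.PneNP.PneNP.Theorems
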